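import Summits.Ventures.PercRepro.S1PoorCapThirteenSix
import Summits.Ventures.PercRepro.S1CoreCapSevenThreeNon

/-!
# PercRepro — THE PLANE-POOR 8-SPREAD LAYER AT NULLITY `7`: `t(7) ≤ 19` AND `total₇ ≤ 63` (p1, gen 35)

`proofs/P1-S2-CORANK6.md` §4p. The landed plain instance `Seven.fourCapSpec_seven` (`Q*(7) = 19`) gives, through the
plane-poor bridge, the per-point cap `tPoor_seven_le_nineteen`: every point of a plane-poor 8-spread matroid of nullity `7`
lies on at most `19` four-circuits; the deletion recursion `ncard_fourCircuits_le_add_of_delete_step` then bounds the TOTAL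
number of four-circuits of such a matroid by `19 + 44 = 63` (`ncard_fourCircuits_le_sixty_three_of_nullity_seven`, on the
nullity-`6` total `44`). This is Case 2 of the solid split at nullity `7` (the five-circuits through a point `e` of a spread
core whose contraction `M ／ {e}` is plane-poor). Nothing about any cell is claimed. Axioms: standard.
-/

open scoped Matroid

namespace PercRepro

namespace S1

open Set

open FourCap

variable {α : Type}

/-- **The plane-poor spec at nullity `7` with `Q = 19`**, from the landed plain instance `Seven.fourCapSpec_seven`. -/
theorem fourCapSpecPoor_seven_nineteen : FourCapSpecPoor capPoor 7 19 :=
  (FourCapSpecPoor.of_fourCapSpec Seven.fourCapSpec_seven (by decide)).mono capPoor_le_capPaper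

/-- **At nullity `7`, a point of a plane-poor 8-spread matroid lies on at most `19` four-circuits.** -/
theorem tPoor_seven_le_nineteen (N : Matroid α) [N.Finite] (hpp : PlanePoor N) (hN8 : Spread8 N)
    (hd : N.E.encard = N.eRank + 7) (f : α) : {C : Set α | N.IsCircuit C ∧ C.ncard = 4 ∧ f ∈ C}.ncard ≤ 19 :=
  ncard_fourCircuitsThrough_le_of_fourCapSpecPoor' N hpp hN8 hd f fourCapSpecPoor_seven_nineteen

/-- **A plane-poor 8-spread matroid of nullity `7` has at most `63` four-circuits** (`19 + 44`). -/
theorem ncard_fourCircuits_le_sixty_three_of_nullity_seven (N : Matroid α) [N.Finite] (hpp : PlanePoor N)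
    (hN8 : Spread8 N) (hd : N.E.encard = N.eRank + 7) : {C : Set α | N.IsCircuit C ∧ C.ncard = 4}.ncard ≤ 63 :=
  ncard_fourCircuits_le_add_of_delete_step N hpp hN8 (d := 6) (by rw [hd]; norm_num)
    (fun x => tPoor_seven_le_nineteen N hpp hN8 hd x)
    (fun N' _ hpp' hN8' hd' => ncard_fourCircuits_le_forty_four_of_nullity_six N' hpp' hN8' hd')

end S1

end PercRepro
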